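import Summits.HodgeConjecture.HodgeConjecture.Theorems.F0P3SpectralPacketHTraceIndep    -- ★ (N) FILE 3h′ p842933: `trPktInfH_const_smul`, `SpectralPacketH.trFinAt_const_smul`, `arch_mul_prod_loc_eq_of_eval_eq₂` (+ ★ 3h `trH`, `trTensorH`, `IsTestPresentationH`, (TF-1)-H `UnramTraceOneH`, `ofUnramified₂` lemmas; ★ 3d′ `mul_prod_eq_of_forall_mul_prod_eq`)
import Literature.NumberTheory.GaloisRepresentations.FrobeniusDensityTheorem               -- ★ `finite_setOf_not_isUnramifiedIn` (only finitely many places of `L⁺` ramify in `L`); brings `Algebra.IsUnramifiedIn`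
import HarnessLib

/-!
# (N) DEFS, FILE 3h″ — THE `H`-SIDE TRACE FUNCTIONAL ON `S₀`-PRESENTATIONS: `IsTestPresentationHOn`, (TF-1)-H∕S₀ `UnramTraceOneHOff`, `trHOn`, (TF-ind)-H∕S₀ `PresentationIndepHOn`
# PROVED, and the FEED from the HUR-guarded kit-law row (KH3′)♭ — the `H`-twin of ★ FILE 3y `F0P3SpectralPacketTraceOn` (Rogawski §13.3 p. 203 l. 1–3; §14.3 pp. 233–234; §4.3 p. 44; §4.5 p. 49)

Cell `hodgecm-mathlib` (D-0151), F0∕P3 «U3-mult», crux H413 (`stmt-HodgeConjecture-24833`), route of record `HCCMUnconditional`.  Squad F0∕P3c∕LH7, seat LH7-typ2 (g3)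
(S7∕C146∕F13 WP2 typist of the T-A ED. 6 rows (KG1′)∕(KH3′)♭; this file = F13 WP1 item (7) «(KH3′) consumers», ✋ by file name on the LH4∕LH7∕R90∕K2 buses 2026-09-04T23:58Z).
R90-TF LEAD K2E1-plan (g8) (F13-SCOPE memo `K2/K2E1-plan/g8/F13-SCOPE.K2E1-plan-g8.md` §1 (f), §3 T3); heir LEAD F0P3a-plan (g22) T21-11 (B)∕(C), T21-14; ref4 (g13) R4-175 (C)
(kernel census of the (TF-1)-H readers); director (g39) s2025 (2) (the guard token `Algebra.IsUnramifiedIn (𝓞 L) v.asIdeal`).  Definition lane (three `Prop`-predicates + one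
functional, explicit binders) + read-backs + two in-house theorems; namespaces of ★ FILE 3h∕3h′ (`…F0P3SpectralPacket.SpectralPacketH`); `--supports stmt-HodgeConjecture-24833
--as helper`.  No instance, no notation, no named fact, no `sorry`; no `Classical` instance in any STATEMENT (the choice lives inside the body of `trHOn` only); never imports a
`Cruxes/…/Lines` module.
HONEST LABEL: HC_CM is proved only modulo the printed citations until rung 0 closes; this file proves no printed statement — it re-defines the `H`-side (T)-slot functional of the
(N) tuple so that its value IS print's `Tr ρ(f^H)` under print's own normalisation OFF A FINITE SET OF PLACES, discharges the bookkeeping law (TF-ind)-H there, and reads the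
restricted normalisation (TF-1)-H∕S₀ off the HUR-guarded kit-law row (KH3′)♭ of the tuple letters (T-A ED. 6); count-neutral.

WHY (the `H`-side replica of ★ 3y's level-mismatch episode).  ★ FILE 3h's total functional `trH ρ νH archTrH F` is `trTensorH` — the product `Tr ρ_∞(TH.arch) · ∏_{v ∈ TH.S}
Tr ρ_v(TH.loc v)` over the bad set of the presentation ONLY — of SOME test presentation `TH` of `F`, whose bad set is only asked to contain `ramH ρ` (★ `IsTestPresentationH`);
print's product [§13.3 p. 203 l. 1–3] runs over ALL places, so the truncation is print's `Tr ρ(f^H)` exactly when every omitted factor `Tr ρ_v(1_{K_{H,v}})` (`ξ_H(ρ_v)`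
unramified, `v ∉ TH.S`) equals `1` — the absolute law (TF-1)-H ★ `UnramTraceOneH`, which the junction derived from the kit-law row (KH3′) `UnramTraceVolH` and the Haar
normalisation `vol(K_{H,v}) = 1` (★ 3h-vol `UnramTraceVolH.unramTraceOneH_of_prod`).  Under the JQ-RAM re-type (director s2025 (2); REF5 R5-371∕R5-373: at a place `v` of
`L⁺` RAMIFIED in `L` an `H_v`-packet `ρ_v = σ ⊠ φ` with `ξ_H(ρ_v)` unramified need not be `K_{H,v}`-spherical, so (KH3′) is not instantiable print-faithfully there) the row
becomes (KH3′)♭ «… at every place `v` UNRAMIFIED IN `L/L⁺` where `ξ_H(ρ_v)` is unramified», and (TF-1)-H survives only off the finite set `RamL` of ramified places: enlarging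
a presentation by a ramified `v₀ ∉ TH.S` (★ `ofUnramified₂ (TH.S ∪ {v₀}) TH.loc TH.arch` presents the same `F`) multiplies `trTensorH` by the unpinned factor
`Tr ρ_{v₀}(1_{K_{H,v₀}})`, so neither ★ `PresentationIndepH` nor any statement about the unfloored ★ `trH` follows from the guarded row.  THE REPAIR is ★ 3y's, on the
`H`-side: PIN THE PRESENTATIONS TO CONTAIN a finite `S₀ ⊇ RamL` (`IsTestPresentationHOn`, `trHOn`), restrict the two laws off∕to `S₀` (`UnramTraceOneHOff`,
`PresentationIndepHOn`), PROVE (TF-ind)-H∕S₀ by ★ 3h′'s argument verbatim on `S₀`-presentations (common bad set `TH.S ∪ TH′.S ⊇ S₀`), and FEED (TF-1)-H∕S₀ from (KH3′)♭ +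
`vol(K_{H,v}) = 1` + «every `v ∉ S₀` is unramified in `L`» (§5; for `S₀ ⊇ RamL := (finite_setOf_not_isUnramifiedIn L⁺ L).toFinset` the last hypothesis is membership).  The
K9 statement takes the `H`-trace functional as DATA, so the junction's (T)-slot `fun ρ => ρ.trH νH archTrH` becomes `fun ρ => ρ.trHOn S₀ νH archTrH` with no change to any
statement text; at `S₀ = ∅`, `trHOn ∅ = trH` (`trHOn_empty`).

CONTENTS.
* §1 (d1) `IsTestPresentationHOn ρ S₀ F TH := ρ.IsTestPresentationH F TH ∧ S₀ ⊆ TH.S`; read-backs `isTestPresentationHOn_iff`, `IsTestPresentationHOn.isTestPresentationH` ∕ `.subset`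
  ∕ `.anti`, `isTestPresentationHOn_empty`, **`exists_isTestPresentationHOn (hT : TH.IsUnramified₂) (hF : ⇑F = TH.eval)`** (re-present at `TH.S ∪ ramH ρ ∪ S₀`, ★
  `eval_ofUnramified₂_of_isUnramified₂`), `exists_isTestPresentationHOn_of_isUnramified₂`.
* §2 (d0) **(TF-1)-H∕S₀ `SpectralPacketH.UnramTraceOneHOff ρ S₀ νH`** — «`Tr ρ_v(1_{K_{H,v}}) = 1` at the places `v ∉ S₀` where `ξ_H(ρ_v)` is unramified» (★ 3h (h5) `UnramTraceOneH`
  restricted); `unramTraceOneHOff_iff`, `UnramTraceOneH.off`, `UnramTraceOneHOff.mono`, `unramTraceOneHOff_empty`, `prod_eq_prod_of_subset_of_unramTraceOneHOff` (enlarging a finite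
  `S ⊇ S₀ ∪ ramH ρ` by places where `f^H_v = 1_{K_{H,v}}` does not change the product); (d2) **`trHOn ρ S₀ νH archTrH : TestH L → ℂ`** — `trTensorH` of SOME `S₀`-presentation if one
  exists, `0` otherwise; (d3) **(TF-ind)-H∕S₀ `PresentationIndepHOn ρ S₀ νH archTrH`** — two `S₀`-presentations of one `F` have the same `trTensorH`.
* §3 read-backs of the functional: `presentationIndepHOn_iff`, `PresentationIndepH.on`, **`trHOn_empty : ρ.trHOn ∅ νH archTrH = ρ.trH νH archTrH`**, `trHOn_of_not`, `trHOn_eq_trTensorH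
  (hind)`, `trTensorH_eq_prod_of_subset_of_off (h1 : UnramTraceOneHOff) (hT : IsTestPresentationHOn)`, and the consumer form **`trHOn_eq_of_isUnramified₂ (hind) (h1) (hT) (hF) S′
  (TH.S ⊆ S′) (ramH ρ ⊆ S′) (S₀ ⊆ S′)`** = ★ 3h′ `trH_eq_of_isUnramified₂` for `trHOn`, with (TF-1)-H used only at `v ∉ S₀`.
* §4 **(TF-ind)-H∕S₀ DISCHARGED — `presentationIndepHOn_of_admissible (h1 : ρ.UnramTraceOneHOff S₀ νH) (hadm) (harch)`** (★ 3h′ `presentationIndepH_of_admissible` line for line, common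
  bad set `TH.S ∪ TH′.S ⊇ S₀`; ★ `arch_mul_prod_loc_eq_of_eval_eq₂`, ★ 3d′ `mul_prod_eq_of_forall_mul_prod_eq`); `trHOn_eq_trTensorH_of_admissible`, `trHOn_eq_of_isUnramified₂_of_admissible`.
* §5 **THE FEED FROM (KH3′)♭** (its kernel shape per `ρ`, guard token `Algebra.IsUnramifiedIn (𝓞 L) v.asIdeal` byte-identical to s2025 (2) ∕ S4 A :208 ∕ T-A ED. 6 :294 ∕ :315–:319):
  `UnramTraceOneHOff.of_forall_isUnramifiedIn` (from the guarded `… = 1` text), **`UnramTraceOneHOff.of_isUnramifiedIn (h : (KH3′)♭ at ρ) (hvolH : vol(K_{H,v}) = 1, `.real` text)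
  (hS₀ : ∀ v ∉ S₀, Algebra.IsUnramifiedIn (𝓞 L) v.asIdeal)`**, `UnramTraceOneHOff.of_isUnramifiedIn_of_prod` (the same with the witness's ENNReal text on the subgroup product, as
  ★ 3h-vol `unramTraceOneH_of_prod`), and the instances at any `S₀ ⊇ RamL := (finite_setOf_not_isUnramifiedIn L⁺ L).toFinset`: `isUnramifiedIn_of_not_mem_of_ramified_subset`,
  **`UnramTraceOneHOff.of_isUnramifiedIn_of_ramified_subset`**, `UnramTraceOneHOff.of_isUnramifiedIn_of_prod_of_ramified_subset` (the membership fact is ★ `isUnramifiedIn_of_not_mem_ramifiedFinset`'s).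

References: [Rogawski1990] §13.3 p. 203 l. 1–3, p. 201 l. 1–4, §13.1 Thm. 13.1.1 p. 198, §14.3 pp. 233–234, §14.6 (14.6.1) p. 241, §4.3 p. 44, §4.5 p. 49; [FlathCorvallis1979] Thm. 3;
[BorelJacquet1979] §4.1; [CartierCorvallis1979] §IV.1.

SPLIT NOTE (gate lint `lint.statement-form`, ≤ 400 lines for a Theorems file with proofs): §5 «the FEED from the HUR-guarded kit-law row (KH3′)♭» lives in the sibling
module `Theorems/F0P3SpectralPacketHTraceOnFeed.lean` (same namespaces), which imports this file; §§1–4 are here unchanged.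
-/

set_option autoImplicit false
-- the mandated namespace repeats `HodgeConjecture.HodgeConjecture`, as in every `Theorems/*.lean` of this sub-problem
set_option linter.dupNamespace false

noncomputable section

open NumberField IsDedekindDomain MeasureTheory Filter
open scoped Matrix MatrixGroups

open Literature.NumberTheory Literature.NumberTheory.Automorphic Literature.NumberTheory.Automorphic.UnitaryGroup
open Literature.NumberTheory.Rogawski1990 Literature.NumberTheory.GaloisRepresentations
open Literature.RepresentationTheory.BorelWallach2000 Literature.RepresentationTheory.KonnoKonno2007
open Summit.HodgeConjecture.HodgeConjecture.Cruxes.H413.F0P3InnerFormClassificationV6 (TestH splitForm)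
open Summit.HodgeConjecture.HodgeConjecture.Cruxes.H413.F0P3LocalPacketKit
open Summit.HodgeConjecture.HodgeConjecture.Cruxes.H413.F0P3ArchPacketKit

namespace Summit.HodgeConjecture.HodgeConjecture.Cruxes.H413.F0P3SpectralPacket

open Summit.HodgeConjecture.HodgeConjecture.Cruxes.H413.F0P3GlobalPacket

variable {L : Type} [Field L] [NumberField L] [IsCMField L] {H' : Matrix (Fin 3) (Fin 3) L}
  {𝔩 : ∀ v : HeightOneSpectrum (𝓞 ↥(maximalRealSubfield L)), LocalPacketKit L H' v} {𝔞 : ArchPacketKit} {𝔞H : ArchPacketKitH 𝔞}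
  {DiscH : GlobalPacketH 𝔩 → 𝔞H.PktInfH → Prop}

namespace SpectralPacketH

/-! ## §1 `S₀`-presentations [§14.3 pp. 233–234; p. 203 l. 1–3] -/

/-- **(d1) `ρ.IsTestPresentationHOn S₀ F TH` — `TH` IS A TEST PRESENTATION OF `F ∈ C_c(H(𝔸))` (★ 3h (h1)) WHOSE BAD SET CONTAINS `S₀`**: `TH.IsUnramified₂`, integral levels,
`ramH ρ ⊆ TH.S`, `⇑F = TH.eval`, AND `S₀ ⊆ TH.S` — print presents `f^H = ⊗ f^H_v` with a bad set containing every place where anything is non-standard [§14.3 pp. 233–234];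
for the (N) tuple after the JQ-RAM re-type, `S₀ ⊇ RamL`. [cite: Rogawski1990, §14.3 pp. 233–234; §13.3 p. 203 l. 1–3] -/
def IsTestPresentationHOn (ρ : SpectralPacketH 𝔩 𝔞 𝔞H DiscH) (S₀ : Finset (HeightOneSpectrum (𝓞 ↥(maximalRealSubfield L)))) (F : TestH L)
    (TH : UnitaryGroup.PureTensor₂ L (splitForm L 2) (splitForm L 1)) : Prop :=
  ρ.IsTestPresentationH F TH ∧ S₀ ⊆ TH.S

variable {ρ : SpectralPacketH 𝔩 𝔞 𝔞H DiscH} {S₀ : Finset (HeightOneSpectrum (𝓞 ↥(maximalRealSubfield L)))}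

/-- Unfolding of (d1). [cite: Rogawski1990, §14.3 pp. 233–234] -/
theorem isTestPresentationHOn_iff (F : TestH L) (TH : UnitaryGroup.PureTensor₂ L (splitForm L 2) (splitForm L 1)) :
    ρ.IsTestPresentationHOn S₀ F TH ↔ ρ.IsTestPresentationH F TH ∧ S₀ ⊆ TH.S :=
  Iff.rfl

/-- An `S₀`-presentation is a test presentation (★ 3h (h1)). [cite: Rogawski1990, §14.3 pp. 233–234] -/
theorem IsTestPresentationHOn.isTestPresentationH {F : TestH L} {TH : UnitaryGroup.PureTensor₂ L (splitForm L 2) (splitForm L 1)}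
    (h : ρ.IsTestPresentationHOn S₀ F TH) : ρ.IsTestPresentationH F TH :=
  h.1

/-- The bad set of an `S₀`-presentation contains `S₀`. [cite: Rogawski1990, §14.3 pp. 233–234] -/
theorem IsTestPresentationHOn.subset {F : TestH L} {TH : UnitaryGroup.PureTensor₂ L (splitForm L 2) (splitForm L 1)}
    (h : ρ.IsTestPresentationHOn S₀ F TH) : S₀ ⊆ TH.S :=
  h.2

/-- An `S₀`-presentation is an `S₁`-presentation for every `S₁ ⊆ S₀`. [cite: Rogawski1990, §14.3 pp. 233–234] -/
theorem IsTestPresentationHOn.anti {F : TestH L} {TH : UnitaryGroup.PureTensor₂ L (splitForm L 2) (splitForm L 1)}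
    (h : ρ.IsTestPresentationHOn S₀ F TH) {S₁ : Finset (HeightOneSpectrum (𝓞 ↥(maximalRealSubfield L)))} (hS : S₁ ⊆ S₀) :
    ρ.IsTestPresentationHOn S₁ F TH :=
  ⟨h.1, hS.trans h.2⟩

/-- At `S₀ = ∅` an `S₀`-presentation is just a test presentation (★ 3h (h1)). [cite: Rogawski1990, §14.3 pp. 233–234] -/
theorem isTestPresentationHOn_empty (F : TestH L) (TH : UnitaryGroup.PureTensor₂ L (splitForm L 2) (splitForm L 1)) :
    ρ.IsTestPresentationHOn ∅ F TH ↔ ρ.IsTestPresentationH F TH :=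
  ⟨fun h => h.1, fun h => ⟨h, Finset.empty_subset _⟩⟩

/-! ### Every unramified₂ pure tensor has an `S₀`-presentation [§14.3 pp. 233–234] -/

/-- **An unramified₂ pure tensor `⇑F = TH.eval` HAS an `S₀`-presentation** with bad set `TH.S ∪ ramH ρ ∪ S₀`, the SAME archimedean factor and the SAME local factors
(★ `PureTensor₂.ofUnramified₂`; ★ `eval_ofUnramified₂_of_isUnramified₂`, ★ `loc_ofUnramified₂_of_isUnramified₂`; ★ 3h `exists_isTestPresentationH` with `S₀` adjoined).
[cite: Rogawski1990, §14.3 pp. 233–234; §13.3 p. 203 l. 1–3] [cite: BorelJacquet1979, §4.1] -/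
theorem exists_isTestPresentationHOn (ρ : SpectralPacketH 𝔩 𝔞 𝔞H DiscH) (S₀ : Finset (HeightOneSpectrum (𝓞 ↥(maximalRealSubfield L)))) {F : TestH L}
    {TH : UnitaryGroup.PureTensor₂ L (splitForm L 2) (splitForm L 1)} (hT : TH.IsUnramified₂) (hF : ⇑F = TH.eval) :
    ∃ TH' : UnitaryGroup.PureTensor₂ L (splitForm L 2) (splitForm L 1), ρ.IsTestPresentationHOn S₀ F TH' ∧ TH.S ⊆ TH'.S ∧ TH'.arch = TH.arch ∧
      ∀ v : HeightOneSpectrum (𝓞 ↥(maximalRealSubfield L)), TH'.loc v = TH.loc v := by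
  classical
  refine ⟨UnitaryGroup.PureTensor₂.ofUnramified₂ L (splitForm L 2) (splitForm L 1) (TH.S ∪ ρ.ramFinsetH ∪ S₀) TH.loc TH.arch,
    ⟨⟨UnitaryGroup.PureTensor₂.ofUnramified₂_isUnramified₂ _ _ _, fun _ => ⟨rfl, rfl⟩, ?_, ?_⟩, ?_⟩, ?_, rfl,
    UnitaryGroup.PureTensor₂.loc_ofUnramified₂_of_isUnramified₂ TH hT _ (Finset.subset_union_left.trans Finset.subset_union_left)⟩
  · rw [UnitaryGroup.PureTensor₂.ofUnramified₂_S]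
    exact Finset.subset_union_right.trans Finset.subset_union_left
  · rw [hF, TH.eval_ofUnramified₂_of_isUnramified₂ hT _ (Finset.subset_union_left.trans Finset.subset_union_left)]
  · rw [UnitaryGroup.PureTensor₂.ofUnramified₂_S]
    exact Finset.subset_union_right
  · rw [UnitaryGroup.PureTensor₂.ofUnramified₂_S]
    exact Finset.subset_union_left.trans Finset.subset_union_left

/-- The junk clause of `trHOn` never fires at an unramified₂ pure tensor: some `S₀`-presentation exists. [cite: Rogawski1990, §14.3 pp. 233–234] -/
theorem exists_isTestPresentationHOn_of_isUnramified₂ (ρ : SpectralPacketH 𝔩 𝔞 𝔞H DiscH) (S₀ : Finset (HeightOneSpectrum (𝓞 ↥(maximalRealSubfield L))))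
    {F : TestH L} {TH : UnitaryGroup.PureTensor₂ L (splitForm L 2) (splitForm L 1)} (hT : TH.IsUnramified₂) (hF : ⇑F = TH.eval) :
    ∃ TH' : UnitaryGroup.PureTensor₂ L (splitForm L 2) (splitForm L 1), ρ.IsTestPresentationHOn S₀ F TH' :=
  (ρ.exists_isTestPresentationHOn S₀ hT hF).imp fun _ h => h.1

/-! ## §2 (TF-1)-H∕S₀, the functional `trHOn`, (TF-ind)-H∕S₀ [p. 203 l. 1–3; §4.3 p. 44; §14.3 pp. 233–234] -/

variable [∀ v : HeightOneSpectrum (𝓞 ↥(maximalRealSubfield L)), MeasurableSpace ((cmDatum L 2 (splitForm L 2)).Local v × (cmDatum L 1 (splitForm L 1)).Local v)]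

/-- **(d0) (TF-1)-H∕S₀ `ρ.UnramTraceOneHOff S₀ νH` — «`Tr ρ_v(1_{K_{H,v}}) = 1` AT THE PLACES `v ∉ S₀` WHERE `ξ_H(ρ_v)` IS UNRAMIFIED»**: ★ FILE 3h (h5) (TF-1)-H `UnramTraceOneH`
RESTRICTED to `v ∉ S₀`.  Print's normalisation [p. 203 l. 1–3 with §4.3 p. 44 «`vol(K_v) = 1`»] is only asked off a finite set: under the JQ-RAM re-type (KH3′)♭ it is known at
the places unramified in `L/L⁺`, i.e. off `RamL` (§5). [cite: Rogawski1990, §13.3 p. 203 l. 1–3; §4.3 p. 44; §4.5 p. 49] [cite: CartierCorvallis1979, §IV.1] -/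
def UnramTraceOneHOff (ρ : SpectralPacketH 𝔩 𝔞 𝔞H DiscH) (S₀ : Finset (HeightOneSpectrum (𝓞 ↥(maximalRealSubfield L))))
    (νH : ∀ v : HeightOneSpectrum (𝓞 ↥(maximalRealSubfield L)), Measure ((cmDatum L 2 (splitForm L 2)).Local v × (cmDatum L 1 (splitForm L 1)).Local v)) : Prop :=
  ∀ v ∉ S₀, (𝔩 v).unr ((𝔩 v).xiH (ρ.fin.loc v)) →
    ρ.trFinAt v (νH v) ((((cmLocalIntegralLevel L 2 (splitForm L 2) v : Set ((cmDatum L 2 (splitForm L 2)).Local v)) ×ˢ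
      (cmLocalIntegralLevel L 1 (splitForm L 1) v : Set ((cmDatum L 1 (splitForm L 1)).Local v)))).indicator fun _ => 1) = 1

/-- Unfolding of (d0). [cite: Rogawski1990, §13.3 p. 203 l. 1–3] -/
theorem unramTraceOneHOff_iff (ρ : SpectralPacketH 𝔩 𝔞 𝔞H DiscH) (S₀ : Finset (HeightOneSpectrum (𝓞 ↥(maximalRealSubfield L))))
    (νH : ∀ v : HeightOneSpectrum (𝓞 ↥(maximalRealSubfield L)), Measure ((cmDatum L 2 (splitForm L 2)).Local v × (cmDatum L 1 (splitForm L 1)).Local v)) :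
    ρ.UnramTraceOneHOff S₀ νH ↔ ∀ v ∉ S₀, (𝔩 v).unr ((𝔩 v).xiH (ρ.fin.loc v)) →
      ρ.trFinAt v (νH v) ((((cmLocalIntegralLevel L 2 (splitForm L 2) v : Set ((cmDatum L 2 (splitForm L 2)).Local v)) ×ˢ
        (cmLocalIntegralLevel L 1 (splitForm L 1) v : Set ((cmDatum L 1 (splitForm L 1)).Local v)))).indicator fun _ => 1) = 1 :=
  Iff.rfl

variable {νH : ∀ v : HeightOneSpectrum (𝓞 ↥(maximalRealSubfield L)), Measure ((cmDatum L 2 (splitForm L 2)).Local v × (cmDatum L 1 (splitForm L 1)).Local v)}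

/-- The absolute law (TF-1)-H (★ 3h (h5)) implies its restriction off any `S₀`. [cite: Rogawski1990, §13.3 p. 203 l. 1–3] -/
theorem UnramTraceOneH.off (h1 : ρ.UnramTraceOneH νH) (S₀ : Finset (HeightOneSpectrum (𝓞 ↥(maximalRealSubfield L)))) : ρ.UnramTraceOneHOff S₀ νH :=
  fun v _ hv => h1 v hv

/-- (TF-1)-H∕S₀ is monotone in `S₀`. [cite: Rogawski1990, §13.3 p. 203 l. 1–3] -/
theorem UnramTraceOneHOff.mono {S₁ : Finset (HeightOneSpectrum (𝓞 ↥(maximalRealSubfield L)))} (h1 : ρ.UnramTraceOneHOff S₀ νH) (h : S₀ ⊆ S₁) :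
    ρ.UnramTraceOneHOff S₁ νH :=
  fun v hv => h1 v fun hv' => hv (h hv')

/-- At `S₀ = ∅`, (TF-1)-H∕S₀ is the absolute law (TF-1)-H. [cite: Rogawski1990, §13.3 p. 203 l. 1–3] -/
theorem unramTraceOneHOff_empty : ρ.UnramTraceOneHOff ∅ νH ↔ ρ.UnramTraceOneH νH :=
  ⟨fun h v hv => h v (Finset.notMem_empty v) hv, fun h => h.off ∅⟩

/-- **Under (TF-1)-H∕S₀, extra places OUTSIDE a finite `S ⊇ S₀ ∪ ramH ρ` with `f^H_v = 1_{K_{H,v}}` do not change a finite product of local packet traces.**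
[cite: Rogawski1990, §13.3 p. 203 l. 1–3] -/
theorem prod_eq_prod_of_subset_of_unramTraceOneHOff (h1 : ρ.UnramTraceOneHOff S₀ νH)
    (f : ∀ v : HeightOneSpectrum (𝓞 ↥(maximalRealSubfield L)), (cmDatum L 2 (splitForm L 2)).Local v × (cmDatum L 1 (splitForm L 1)).Local v → ℂ)
    (S S' : Finset (HeightOneSpectrum (𝓞 ↥(maximalRealSubfield L)))) (hSS' : S ⊆ S') (hram : ρ.ramFinsetH ⊆ S) (hS₀ : S₀ ⊆ S)
    (hf : ∀ v ∈ S', v ∉ S → f v = ((cmLocalIntegralLevel L 2 (splitForm L 2) v : Set ((cmDatum L 2 (splitForm L 2)).Local v)) ×ˢ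
      (cmLocalIntegralLevel L 1 (splitForm L 1) v : Set ((cmDatum L 1 (splitForm L 1)).Local v))).indicator fun _ => 1) :
    ∏ v ∈ S', ρ.trFinAt v (νH v) (f v) = ∏ v ∈ S, ρ.trFinAt v (νH v) (f v) := by
  refine (Finset.prod_subset hSS' fun v hvS' hvS => ?_).symm
  rw [hf v hvS' hvS]
  exact h1 v (fun h => hvS (hS₀ h)) (ρ.unr_xiH_of_not_mem_ramFinsetH fun h => hvS (hram h))

/-- **(d2) `ρ.trHOn S₀ νH archTrH : TestH L → ℂ` — THE TUPLE'S `trH ρ` READ ON `S₀`-PRESENTATIONS**: `trTensorH` (★ 3h (h2), `Tr ρ_∞(TH.arch) · ∏_{v ∈ TH.S} Tr ρ_v(TH.loc v)`)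
of SOME test presentation of `F` with bad set `⊇ S₀` when one exists (choice; independent of it under (TF-ind)-H∕S₀, `trHOn_eq_trTensorH`, and (TF-ind)-H∕S₀ is PROVED in
§4), `0` otherwise — a value no consumer reads (clause (T) meets only matched `f^H`, unramified₂ pure tensors by pin (xi″-c); `trHOn_eq_of_isUnramified₂`).  Under print's
normalisation off `S₀` this IS `Tr ρ(f^H)` [p. 203 l. 1–3], every omitted factor being `Tr ρ_v(1_{K_{H,v}}) = 1`.
[cite: Rogawski1990, §13.3 p. 203 l. 1–3; §14.3 pp. 233–234; §14.6 (14.6.1) p. 241; §4.3 p. 44] -/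
def trHOn (ρ : SpectralPacketH 𝔩 𝔞 𝔞H DiscH) (S₀ : Finset (HeightOneSpectrum (𝓞 ↥(maximalRealSubfield L))))
    (νH : ∀ v : HeightOneSpectrum (𝓞 ↥(maximalRealSubfield L)), Measure ((cmDatum L 2 (splitForm L 2)).Local v × (cmDatum L 1 (splitForm L 1)).Local v))
    (archTrH : 𝔞H.CinfH → (UnitaryGroup.arch (↥(maximalRealSubfield L)) L (IsCMField.complexConj L) 2 (splitForm L 2) ×
      UnitaryGroup.arch (↥(maximalRealSubfield L)) L (IsCMField.complexConj L) 1 (splitForm L 1) → ℂ) → ℂ)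
    (F : TestH L) : ℂ :=
  open scoped Classical in
  if h : ∃ TH : UnitaryGroup.PureTensor₂ L (splitForm L 2) (splitForm L 1), ρ.IsTestPresentationHOn S₀ F TH then ρ.trTensorH νH archTrH h.choose else 0

/-- **(d3) (TF-ind)-H∕S₀ `ρ.PresentationIndepHOn S₀ νH archTrH`** — two test presentations of one `F ∈ C_c(H(𝔸))` WITH BAD SETS `⊇ S₀` have the same `trTensorH` (★ 3h (h4)
restricted; print p. 203 l. 1–3 «well-defined»; PROVED in §4 modulo (TF-1)-H∕S₀, admissibility and homogeneity of `archTrH`). [cite: Rogawski1990, §13.3 p. 203 l. 1–3]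
[cite: FlathCorvallis1979, Thm. 3] -/
def PresentationIndepHOn (ρ : SpectralPacketH 𝔩 𝔞 𝔞H DiscH) (S₀ : Finset (HeightOneSpectrum (𝓞 ↥(maximalRealSubfield L))))
    (νH : ∀ v : HeightOneSpectrum (𝓞 ↥(maximalRealSubfield L)), Measure ((cmDatum L 2 (splitForm L 2)).Local v × (cmDatum L 1 (splitForm L 1)).Local v))
    (archTrH : 𝔞H.CinfH → (UnitaryGroup.arch (↥(maximalRealSubfield L)) L (IsCMField.complexConj L) 2 (splitForm L 2) ×
      UnitaryGroup.arch (↥(maximalRealSubfield L)) L (IsCMField.complexConj L) 1 (splitForm L 1) → ℂ) → ℂ) : Prop :=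
  ∀ (F : TestH L) (TH TH' : UnitaryGroup.PureTensor₂ L (splitForm L 2) (splitForm L 1)),
    ρ.IsTestPresentationHOn S₀ F TH → ρ.IsTestPresentationHOn S₀ F TH' → ρ.trTensorH νH archTrH TH = ρ.trTensorH νH archTrH TH'

/-! ## §3 Read-backs of the functional -/

variable {archTrH : 𝔞H.CinfH → (UnitaryGroup.arch (↥(maximalRealSubfield L)) L (IsCMField.complexConj L) 2 (splitForm L 2) ×
    UnitaryGroup.arch (↥(maximalRealSubfield L)) L (IsCMField.complexConj L) 1 (splitForm L 1) → ℂ) → ℂ}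

/-- Unfolding of (d3). [cite: Rogawski1990, §13.3 p. 203 l. 1–3] -/
theorem presentationIndepHOn_iff :
    ρ.PresentationIndepHOn S₀ νH archTrH ↔ ∀ (F : TestH L) (TH TH' : UnitaryGroup.PureTensor₂ L (splitForm L 2) (splitForm L 1)),
      ρ.IsTestPresentationHOn S₀ F TH → ρ.IsTestPresentationHOn S₀ F TH' → ρ.trTensorH νH archTrH TH = ρ.trTensorH νH archTrH TH' :=
  Iff.rfl

/-- The absolute law (TF-ind)-H (★ 3h (h4)) implies (TF-ind)-H∕S₀. [cite: Rogawski1990, §13.3 p. 203 l. 1–3] -/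
theorem PresentationIndepH.on (hind : ρ.PresentationIndepH νH archTrH) (S₀ : Finset (HeightOneSpectrum (𝓞 ↥(maximalRealSubfield L)))) :
    ρ.PresentationIndepHOn S₀ νH archTrH :=
  fun F TH TH' hT hT' => hind F TH TH' hT.1 hT'.1

/-- **At `S₀ = ∅`, `trHOn` IS ★ 3h's `trH`** (the junction's (T)-slot before F13): `ρ.trHOn ∅ νH archTrH = ρ.trH νH archTrH`. [cite: Rogawski1990, §13.3 p. 203 l. 1–3] -/
theorem trHOn_empty (ρ : SpectralPacketH 𝔩 𝔞 𝔞H DiscH)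
    (νH : ∀ v : HeightOneSpectrum (𝓞 ↥(maximalRealSubfield L)), Measure ((cmDatum L 2 (splitForm L 2)).Local v × (cmDatum L 1 (splitForm L 1)).Local v))
    (archTrH : 𝔞H.CinfH → (UnitaryGroup.arch (↥(maximalRealSubfield L)) L (IsCMField.complexConj L) 2 (splitForm L 2) ×
      UnitaryGroup.arch (↥(maximalRealSubfield L)) L (IsCMField.complexConj L) 1 (splitForm L 1) → ℂ) → ℂ) :
    ρ.trHOn ∅ νH archTrH = ρ.trH νH archTrH := by
  have h : ρ.IsTestPresentationHOn ∅ = ρ.IsTestPresentationH :=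
    funext fun F => funext fun TH => propext (isTestPresentationHOn_empty F TH)
  funext F
  unfold trHOn
  rw [h]
  rfl

/-- **The junk clause**: off the unramified₂ pure tensors `S₀`-presented at the integral levels, `trHOn := 0`. [cite: Rogawski1990, §13.3 p. 203 l. 1–3] -/
theorem trHOn_of_not {F : TestH L} (h : ¬ ∃ TH : UnitaryGroup.PureTensor₂ L (splitForm L 2) (splitForm L 1), ρ.IsTestPresentationHOn S₀ F TH) :
    ρ.trHOn S₀ νH archTrH F = 0 := by
  rw [trHOn, dif_neg h]

/-- **Under (TF-ind)-H∕S₀, `trHOn S₀` is the product of ANY `S₀`-presentation of `F`.** [cite: Rogawski1990, §13.3 p. 203 l. 1–3] -/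
theorem trHOn_eq_trTensorH (hind : ρ.PresentationIndepHOn S₀ νH archTrH) {F : TestH L} {TH : UnitaryGroup.PureTensor₂ L (splitForm L 2) (splitForm L 1)}
    (hT : ρ.IsTestPresentationHOn S₀ F TH) : ρ.trHOn S₀ νH archTrH F = ρ.trTensorH νH archTrH TH := by
  have h : ∃ TH' : UnitaryGroup.PureTensor₂ L (splitForm L 2) (splitForm L 1), ρ.IsTestPresentationHOn S₀ F TH' := ⟨TH, hT⟩
  rw [trHOn, dif_pos h]
  exact hind F _ _ h.choose_spec hT

/-- **Under (TF-1)-H∕S₀, `trTensorH` of an `S₀`-presentation is the product over ANY finite `S′ ⊇ TH.S`** (the extra places lie outside `TH.S ⊇ S₀ ∪ ramH ρ`, where the factor is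
`Tr ρ_v(1_{K_{H,v}}) = 1`; ★ 3h `trTensorH_eq_prod_of_subset` with (TF-1)-H used only at `v ∉ S₀`). [cite: Rogawski1990, §13.3 p. 203 l. 1–3] -/
theorem trTensorH_eq_prod_of_subset_of_off (h1 : ρ.UnramTraceOneHOff S₀ νH) {F : TestH L}
    {TH : UnitaryGroup.PureTensor₂ L (splitForm L 2) (splitForm L 1)} (hT : ρ.IsTestPresentationHOn S₀ F TH)
    (S' : Finset (HeightOneSpectrum (𝓞 ↥(maximalRealSubfield L)))) (hS : TH.S ⊆ S') :
    ρ.trTensorH νH archTrH TH = 𝔞H.trPktInfH archTrH ρ.inf TH.arch * ∏ v ∈ S', ρ.trFinAt v (νH v) (TH.loc v) := by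
  rw [trTensorH_eq, ρ.prod_eq_prod_of_subset_of_unramTraceOneHOff h1 TH.loc TH.S S' hS hT.1.2.2.1 hT.2 fun v _ hv => by
    rw [TH.loc_eq_indicator v hv, (hT.1.2.1 v).1, (hT.1.2.1 v).2]]

/-- **CONSUMER FORM — `trHOn S₀` AT AN UNRAMIFIED₂ PURE TENSOR IS THE PRODUCT over any finite `S′ ⊇ TH.S ∪ ramH ρ ∪ S₀`** (under (TF-ind)-H∕S₀ and (TF-1)-H∕S₀; ★ 3h′
`trH_eq_of_isUnramified₂` for `trHOn`, (TF-1)-H now used only at places `v ∉ S₀`): with pin (xi″-c) this is what clause (T) reads at every matched `f^H` — never junk there.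
[cite: Rogawski1990, §13.3 p. 203 l. 1–3; §14.3 pp. 233–234; §14.6 (14.6.1) p. 241] -/
theorem trHOn_eq_of_isUnramified₂ (hind : ρ.PresentationIndepHOn S₀ νH archTrH) (h1 : ρ.UnramTraceOneHOff S₀ νH) {F : TestH L}
    {TH : UnitaryGroup.PureTensor₂ L (splitForm L 2) (splitForm L 1)} (hT : TH.IsUnramified₂) (hF : ⇑F = TH.eval)
    (S' : Finset (HeightOneSpectrum (𝓞 ↥(maximalRealSubfield L)))) (hS : TH.S ⊆ S') (hram : ρ.ramFinsetH ⊆ S') (hS₀ : S₀ ⊆ S') :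
    ρ.trHOn S₀ νH archTrH F = 𝔞H.trPktInfH archTrH ρ.inf TH.arch * ∏ v ∈ S', ρ.trFinAt v (νH v) (TH.loc v) := by
  classical
  obtain ⟨T', hT', -, harch, hloc⟩ := ρ.exists_isTestPresentationHOn S₀ hT hF
  -- `T′.S ⊆ S′` is not known, so pass through `T′.S ∪ S′` twice ((TF-1)-H∕S₀ at `v ∉ S′ ⊇ S₀ ∪ ramH ρ`)
  have hprod' : ∏ v ∈ S', ρ.trFinAt v (νH v) (TH.loc v) = ∏ v ∈ T'.S ∪ S', ρ.trFinAt v (νH v) (TH.loc v) :=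
    Finset.prod_subset Finset.subset_union_right fun v _ hv => by
      rw [TH.loc_eq_indicator v (fun h => hv (hS h)), (hT v (fun h => hv (hS h))).1, (hT v (fun h => hv (hS h))).2]
      exact h1 v (fun h => hv (hS₀ h)) (ρ.unr_xiH_of_not_mem_ramFinsetH fun h => hv (hram h))
  rw [ρ.trHOn_eq_trTensorH hind hT', ρ.trTensorH_eq_prod_of_subset_of_off h1 hT' (T'.S ∪ S') Finset.subset_union_left, harch, hprod']
  exact congrArg _ (Finset.prod_congr rfl fun v _ => by rw [hloc v])

/-! ## §4 (TF-ind)-H∕S₀ discharged [p. 203 l. 1–3; FlathCorvallis1979 Thm. 3] -/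

variable [∀ v : HeightOneSpectrum (𝓞 ↥(maximalRealSubfield L)), BorelSpace ((cmDatum L 2 (splitForm L 2)).Local v × (cmDatum L 1 (splitForm L 1)).Local v)]
  [∀ v, (νH v).IsMulLeftInvariant] [∀ v, IsFiniteMeasureOnCompacts (νH v)]

/-- **(TF-ind)-H∕S₀ DISCHARGED — `ρ.PresentationIndepHOn S₀ νH archTrH`**, modulo (TF-1)-H∕S₀ `UnramTraceOneHOff`, admissibility of the members of every `ρ_v`, and
homogeneity of the `H_∞`-characters `archTrH` (★ 3h′ `presentationIndepH_of_admissible`, line for line, the common bad set `TH.S ∪ TH′.S` now containing `S₀`, so that (TF-1)-H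
is spent only at places `v ∉ S₀`). [cite: Rogawski1990, §13.3 p. 203 l. 1–3] [cite: FlathCorvallis1979, Thm. 3] [cite: BorelJacquet1979, §4.1] -/
theorem presentationIndepHOn_of_admissible (ρ : SpectralPacketH 𝔩 𝔞 𝔞H DiscH) (S₀ : Finset (HeightOneSpectrum (𝓞 ↥(maximalRealSubfield L))))
    (h1 : ρ.UnramTraceOneHOff S₀ νH)
    (hadm : ∀ (v : HeightOneSpectrum (𝓞 ↥(maximalRealSubfield L))), ∀ σ ∈ (𝔩 v).memH (ρ.fin.loc v), σ.IsAdmissible)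
    (harch : ∀ (c : 𝔞H.CinfH) (k : ℂ) (f : UnitaryGroup.arch (↥(maximalRealSubfield L)) L (IsCMField.complexConj L) 2 (splitForm L 2) ×
      UnitaryGroup.arch (↥(maximalRealSubfield L)) L (IsCMField.complexConj L) 1 (splitForm L 1) → ℂ), archTrH c (k • f) = k * archTrH c f) :
    ρ.PresentationIndepHOn S₀ νH archTrH := by
  classical
  intro F TH TH' hT hT'
  -- common bad set and the re-presentations there
  set S'' := TH.S ∪ TH'.S with hS''
  set T₁ := UnitaryGroup.PureTensor₂.ofUnramified₂ L (splitForm L 2) (splitForm L 1) S'' TH.loc TH.arch with hT₁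
  set T₁' := UnitaryGroup.PureTensor₂.ofUnramified₂ L (splitForm L 2) (splitForm L 1) S'' TH'.loc TH'.arch with hT₁'
  have hl : ∀ v, T₁.loc v = TH.loc v := UnitaryGroup.PureTensor₂.loc_ofUnramified₂_of_isUnramified₂ TH hT.1.1 S'' Finset.subset_union_left
  have hl' : ∀ v, T₁'.loc v = TH'.loc v := UnitaryGroup.PureTensor₂.loc_ofUnramified₂_of_isUnramified₂ TH' hT'.1.1 S'' Finset.subset_union_right
  have he : T₁.eval = T₁'.eval := by
    rw [hT₁, hT₁', TH.eval_ofUnramified₂_of_isUnramified₂ hT.1.1 S'' Finset.subset_union_left,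
      TH'.eval_ofUnramified₂_of_isUnramified₂ hT'.1.1 S'' Finset.subset_union_right, ← hT.1.2.2.2, ← hT'.1.2.2.2]
  -- the box identity at `S''`
  have hbox : ∀ (xinf : UnitaryGroup.arch (↥(maximalRealSubfield L)) L (IsCMField.complexConj L) 2 (splitForm L 2) ×
        UnitaryGroup.arch (↥(maximalRealSubfield L)) L (IsCMField.complexConj L) 1 (splitForm L 1))
      (x : ∀ v : HeightOneSpectrum (𝓞 ↥(maximalRealSubfield L)), (cmDatum L 2 (splitForm L 2)).Local v × (cmDatum L 1 (splitForm L 1)).Local v),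
      TH.arch xinf * ∏ v ∈ S'', TH.loc v (x v) = TH'.arch xinf * ∏ v ∈ S'', TH'.loc v (x v) := by
    intro xinf x
    have h := arch_mul_prod_loc_eq_of_eval_eq₂ T₁ T₁' (UnitaryGroup.PureTensor₂.ofUnramified₂_isUnramified₂ _ _ _)
      (UnitaryGroup.PureTensor₂.ofUnramified₂_isUnramified₂ _ _ _) rfl he xinf x
    have e1 : ∏ v ∈ S'', T₁.loc v (x v) = ∏ v ∈ S'', TH.loc v (x v) := Finset.prod_congr rfl fun v _ => by rw [hl v]
    have e2 : ∏ v ∈ S'', T₁'.loc v (x v) = ∏ v ∈ S'', TH'.loc v (x v) := Finset.prod_congr rfl fun v _ => by rw [hl' v]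
    have ha : T₁.arch = TH.arch := rfl
    have ha' : T₁'.arch = TH'.arch := rfl
    have hS₁ : T₁.S = S'' := rfl
    rw [hS₁, e1, e2, ha, ha'] at h
    exact h
  -- both values as products over `S''` ((TF-1)-H only at `v ∉ TH.S ⊇ S₀`, resp. `v ∉ TH′.S ⊇ S₀`), then the ★ generic of FILE 3d′
  rw [ρ.trTensorH_eq_prod_of_subset_of_off h1 hT S'' Finset.subset_union_left, ρ.trTensorH_eq_prod_of_subset_of_off h1 hT' S'' Finset.subset_union_right]
  exact mul_prod_eq_of_forall_mul_prod_eq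
    (X₀ := UnitaryGroup.arch (↥(maximalRealSubfield L)) L (IsCMField.complexConj L) 2 (splitForm L 2) ×
      UnitaryGroup.arch (↥(maximalRealSubfield L)) L (IsCMField.complexConj L) 1 (splitForm L 1))
    (X := fun v : HeightOneSpectrum (𝓞 ↥(maximalRealSubfield L)) => (cmDatum L 2 (splitForm L 2)).Local v × (cmDatum L 1 (splitForm L 1)).Local v)
    (𝔞H.trPktInfH archTrH ρ.inf) (fun v => ρ.trFinAt v (νH v))
    (trPktInfH_const_smul 𝔞H archTrH harch ρ.inf) (fun v k f => ρ.trFinAt_const_smul v (νH v) (hadm v) k f)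
    TH.loc TH'.loc S'' TH.arch TH'.arch hbox

/-- **Hence, under the same three hypotheses, `trHOn S₀ F` IS the product of ANY `S₀`-presentation.** [cite: Rogawski1990, §13.3 p. 203 l. 1–3] -/
theorem trHOn_eq_trTensorH_of_admissible (ρ : SpectralPacketH 𝔩 𝔞 𝔞H DiscH) (S₀ : Finset (HeightOneSpectrum (𝓞 ↥(maximalRealSubfield L))))
    (h1 : ρ.UnramTraceOneHOff S₀ νH)
    (hadm : ∀ (v : HeightOneSpectrum (𝓞 ↥(maximalRealSubfield L))), ∀ σ ∈ (𝔩 v).memH (ρ.fin.loc v), σ.IsAdmissible)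
    (harch : ∀ (c : 𝔞H.CinfH) (k : ℂ) (f : UnitaryGroup.arch (↥(maximalRealSubfield L)) L (IsCMField.complexConj L) 2 (splitForm L 2) ×
      UnitaryGroup.arch (↥(maximalRealSubfield L)) L (IsCMField.complexConj L) 1 (splitForm L 1) → ℂ), archTrH c (k • f) = k * archTrH c f)
    {F : TestH L} {TH : UnitaryGroup.PureTensor₂ L (splitForm L 2) (splitForm L 1)} (hT : ρ.IsTestPresentationHOn S₀ F TH) :
    ρ.trHOn S₀ νH archTrH F = ρ.trTensorH νH archTrH TH :=
  ρ.trHOn_eq_trTensorH (ρ.presentationIndepHOn_of_admissible S₀ h1 hadm harch) hT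

/-- **… and the consumer form with (TF-ind)-H∕S₀ discharged**: `trHOn S₀ F = Tr ρ_∞(TH.arch) · ∏_{v ∈ S′} Tr ρ_v(TH.loc v)` for an unramified₂ pure tensor `⇑F = TH.eval`
and any finite `S′ ⊇ TH.S ∪ ramH ρ ∪ S₀`. [cite: Rogawski1990, §13.3 p. 203 l. 1–3; §14.3 pp. 233–234; §14.6 (14.6.1) p. 241] -/
theorem trHOn_eq_of_isUnramified₂_of_admissible (ρ : SpectralPacketH 𝔩 𝔞 𝔞H DiscH) (S₀ : Finset (HeightOneSpectrum (𝓞 ↥(maximalRealSubfield L))))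
    (h1 : ρ.UnramTraceOneHOff S₀ νH)
    (hadm : ∀ (v : HeightOneSpectrum (𝓞 ↥(maximalRealSubfield L))), ∀ σ ∈ (𝔩 v).memH (ρ.fin.loc v), σ.IsAdmissible)
    (harch : ∀ (c : 𝔞H.CinfH) (k : ℂ) (f : UnitaryGroup.arch (↥(maximalRealSubfield L)) L (IsCMField.complexConj L) 2 (splitForm L 2) ×
      UnitaryGroup.arch (↥(maximalRealSubfield L)) L (IsCMField.complexConj L) 1 (splitForm L 1) → ℂ), archTrH c (k • f) = k * archTrH c f)
    {F : TestH L} {TH : UnitaryGroup.PureTensor₂ L (splitForm L 2) (splitForm L 1)} (hT : TH.IsUnramified₂) (hF : ⇑F = TH.eval)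
    (S' : Finset (HeightOneSpectrum (𝓞 ↥(maximalRealSubfield L)))) (hS : TH.S ⊆ S') (hram : ρ.ramFinsetH ⊆ S') (hS₀ : S₀ ⊆ S') :
    ρ.trHOn S₀ νH archTrH F = 𝔞H.trPktInfH archTrH ρ.inf TH.arch * ∏ v ∈ S', ρ.trFinAt v (νH v) (TH.loc v) :=
  ρ.trHOn_eq_of_isUnramified₂ (ρ.presentationIndepHOn_of_admissible S₀ h1 hadm harch) h1 hT hF S' hS hram hS₀

end SpectralPacketH

end Summit.HodgeConjecture.HodgeConjecture.Cruxes.H413.F0P3SpectralPacket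

end
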